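import Mathlib
import HarnessLib
import Summits.Ventures.LatticeQCDFlow.Exactness.NCMCGeneralSpaceAcceptance
import Summits.Ventures.LatticeQCDFlow.Exactness.NCMCGeneralSpaceRelativeEntropy

/-!
# The switch acceptance is the overlap of the forward and reverse path laws (one minus their total variation)

HONEST FRAMING: exact (Metropolis-corrected) sampling algorithms for lattice gauge theory;
figures of merit are autocorrelation/cost numbers at stated couplings and volumes; no
continuum-physics claim.

Venture `LatticeQCDFlow` (cell pub-lqcd), topic `Exactness`; FANOUT row 13 (`eng-snf`, GEN-10).
NEW WORK of the cell (general measure theory, elementary), not a published result; nothing is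
cited as a fact (Crooks 1998/2000; Nilmeier–Crooks–Minh–Chodera 2011 named only).  General-state-space
counterpart of row 8's finite `Exactness/NCMCAcceptance.ncmcAccRate_eq_one_sub_tvDist`
(`acc_NCMC = 1 − ‖P_F − P_R‖_TV` on finite path spaces, with the tree's finite `tvDist`).  Setting of
`NCMCGeneralSpace.lean` / `NCMCGeneralSpaceDissipation.lean` / `NCMCGeneralSpaceRelativeEntropy.lean`:
a Crooks pair from `ν₀` to `ν₁` on a general measurable state space, normalised record laws
`P_F = fwdPathLaw ν₀ κF`, `P_R = fwdPathLaw ν₁ κR` on the same space of records, `e^{−ΔF} = Z₁/Z₀`.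

## Content

* `CrooksPair.lintegral_accF_fwdPathLaw` — the NORMALISED two-direction formula, every `c`:
  `E_{P_F}[min(1, e^{−(W−c)})] = P_F{W ≤ c} + e^{c−ΔF} · P_R{c < W}`
  (`NCMCGeneralSpaceAcceptance.lintegral_accF_eq` divided by `Z₀`); at `c = ΔF`
  (`lintegral_accF_freeEnergyDiff`, real form `integral_accept_freeEnergyDiff`):
  `acc(ΔF) = P_F{W ≤ ΔF} + P_R{W > ΔF}`; `lintegral_accF_eq_exp_mul_lintegral_accR` — the two
  lanes' normalised acceptance rates differ by the factor `e^{c−ΔF}` (equal exactly at `c = ΔF`: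
  Bennett's acceptance-ratio equation with the Metropolis function, population form).
* `CrooksPair.integral_accept_rev_eq` (the reverse lane's rate at `c = ΔF` is the same real number),
  `integrable_accept`, `integrable_density` / `integral_density_eq_one` (`d = e^{ΔF−W}` is
  `P_F`-integrable with mean one) — bookkeeping for this and later files;
* `CrooksPair.revPathLaw_le_of_subset` / `fwdPathLaw_le_of_subset` — on records with `W > ΔF` the
  reverse law is dominated by the forward law, on records with `W ≤ ΔF` the forward law by the
  reverse law (the density is `e^{ΔF − W}`).
* **`CrooksPair.abs_measureReal_sub_le_one_sub_accept`** — for EVERY measurable set of records `A`,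
  `|P_F(A) − P_R(A)| ≤ 1 − acc(ΔF)`, with equality at `A = {W > ΔF}`
  (`measureReal_sub_eq_one_sub_accept`): THE MEAN ACCEPTANCE OF THE METROPOLIZED SWITCH AT
  `c = ΔF` IS ONE MINUS THE TOTAL-VARIATION DISTANCE BETWEEN THE FORWARD AND THE REVERSE PATH LAWS —
  the rejection rate is exactly the largest discrepancy in probability that any test on evolution
  records can exhibit between the two lanes (stated in this operational, supremum-over-events form;
  Mathlib has no total-variation metric on measures to name); `one_sub_accept_eq_half_integral_abs`
  — the `L¹` form `1 − acc(ΔF) = ½ E_{P_F}|1 − e^{ΔF−W}|`; `accept_eq_one_iff` — full acceptance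
  iff `P_F = P_R` (iff `W = ΔF` a.s.); `lintegral_accF_eq_lintegral_accR_iff` — equal normalised
  forward / reverse acceptance rates at `c` iff `c = ΔF`.

Nothing is claimed about any VALUE of an acceptance for a concrete protocol.
-/

namespace Summit.Ventures.LatticeQCDFlow.Exactness.GeneralNCMC

open MeasureTheory ProbabilityTheory Set Filter
open scoped ENNReal

variable {Ω E : Type*} [MeasurableSpace Ω] [MeasurableSpace E]

namespace CrooksPair

variable {ν₀ ν₁ : Measure Ω} {κF κR : Kernel Ω E} {s e : E → Ω} {W : E → ℝ}

/-! ## The normalised two-direction formula -/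

/-- **Two-direction formula, normalised**: for every `c`,
`E_{P_F}[min(1, e^{−(W−c)})] = P_F{W ≤ c} + e^{c−ΔF} · P_R{c < W}`. -/
theorem lintegral_accF_fwdPathLaw [IsFiniteMeasure ν₀] [IsFiniteMeasure ν₁] (h0 : ν₀ univ ≠ 0)
    (h1 : ν₁ univ ≠ 0) (h : CrooksPair ν₀ ν₁ κF κR s e W) {ΔF : ℝ}
    (hΔF : Real.exp (-ΔF) = ((ν₀ univ)⁻¹ * ν₁ univ).toReal) (c : ℝ) :
    ∫⁻ ε, accF c W ε ∂(fwdPathLaw ν₀ κF) =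
      fwdPathLaw ν₀ κF {ε | W ε ≤ c} +
        ENNReal.ofReal (Real.exp (c - ΔF)) * fwdPathLaw ν₁ κR {ε | c < W ε} := by
  have hr0 : (ν₀ univ)⁻¹ * ν₁ univ ≠ ⊤ :=
    ENNReal.mul_ne_top (ENNReal.inv_ne_top.2 h0) (measure_ne_top ν₁ univ)
  have hΔ : ENNReal.ofReal (Real.exp (-ΔF)) = (ν₀ univ)⁻¹ * ν₁ univ := by
    rw [hΔF, ENNReal.ofReal_toReal hr0]
  rw [fwdPathLaw, fwdPathLaw, lintegral_smul_measure, h.lintegral_accF_eq c, smul_eq_mul,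
    Measure.smul_apply, Measure.smul_apply, smul_eq_mul, smul_eq_mul, mul_add, sub_eq_add_neg,
    Real.exp_add, ENNReal.ofReal_mul (Real.exp_pos c).le, hΔ]
  congr 1
  rw [show ENNReal.ofReal (Real.exp c) * ((ν₀ univ)⁻¹ * ν₁ univ) * ((ν₁ univ)⁻¹ * (ν₁.bind κR) {ε | c < W ε}) =
      (ν₀ univ)⁻¹ * (ENNReal.ofReal (Real.exp c) * (ν₁.bind κR) {ε | c < W ε}) *
        (ν₁ univ * (ν₁ univ)⁻¹) by ring,
    ENNReal.mul_inv_cancel h1 (measure_ne_top ν₁ univ), mul_one]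

/-- **At `c = ΔF`**: `acc(ΔF) = P_F{W ≤ ΔF} + P_R{ΔF < W}` — non-positive dissipation is accepted
surely, the rest is paid for by the reverse lane. -/
theorem lintegral_accF_freeEnergyDiff [IsFiniteMeasure ν₀] [IsFiniteMeasure ν₁] (h0 : ν₀ univ ≠ 0)
    (h1 : ν₁ univ ≠ 0) (h : CrooksPair ν₀ ν₁ κF κR s e W) {ΔF : ℝ}
    (hΔF : Real.exp (-ΔF) = ((ν₀ univ)⁻¹ * ν₁ univ).toReal) :
    ∫⁻ ε, accF ΔF W ε ∂(fwdPathLaw ν₀ κF) =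
      fwdPathLaw ν₀ κF {ε | W ε ≤ ΔF} + fwdPathLaw ν₁ κR {ε | ΔF < W ε} := by
  rw [h.lintegral_accF_fwdPathLaw h0 h1 hΔF ΔF, sub_self, Real.exp_zero, ENNReal.ofReal_one, one_mul]

/-- **The two lanes' normalised acceptance rates differ by the factor `e^{c−ΔF}`, for every `c`**:
`E_{P_F}[min(1, e^{−(W−c)})] = e^{c−ΔF} · E_{P_R}[min(1, e^{W−c})]` — equal exactly at `c = ΔF`;
read backwards, `ΔF = c − log(acc_F(c)/acc_R(c))` is Bennett's acceptance-ratio estimate with the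
Metropolis function (population form). -/
theorem lintegral_accF_eq_exp_mul_lintegral_accR [IsFiniteMeasure ν₀] [IsFiniteMeasure ν₁]
    (h0 : ν₀ univ ≠ 0) (h1 : ν₁ univ ≠ 0) (h : CrooksPair ν₀ ν₁ κF κR s e W) {ΔF : ℝ}
    (hΔF : Real.exp (-ΔF) = ((ν₀ univ)⁻¹ * ν₁ univ).toReal) (c : ℝ) :
    ∫⁻ ε, accF c W ε ∂(fwdPathLaw ν₀ κF) =
      ENNReal.ofReal (Real.exp (c - ΔF)) * ∫⁻ ε, accR c W ε ∂(fwdPathLaw ν₁ κR) := by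
  have hr0 : (ν₀ univ)⁻¹ * ν₁ univ ≠ ⊤ :=
    ENNReal.mul_ne_top (ENNReal.inv_ne_top.2 h0) (measure_ne_top ν₁ univ)
  have hΔ : ENNReal.ofReal (Real.exp (-ΔF)) = (ν₀ univ)⁻¹ * ν₁ univ := by
    rw [hΔF, ENNReal.ofReal_toReal hr0]
  rw [fwdPathLaw, fwdPathLaw, lintegral_smul_measure, lintegral_smul_measure,
    h.lintegral_accF_eq_lintegral_accR c, smul_eq_mul, smul_eq_mul, sub_eq_add_neg, Real.exp_add,
    ENNReal.ofReal_mul (Real.exp_pos c).le, hΔ]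
  rw [show ENNReal.ofReal (Real.exp c) * ((ν₀ univ)⁻¹ * ν₁ univ) *
        ((ν₁ univ)⁻¹ * ∫⁻ ε, accR c W ε ∂(ν₁.bind κR)) =
      (ν₀ univ)⁻¹ * (ENNReal.ofReal (Real.exp c) * ∫⁻ ε, accR c W ε ∂(ν₁.bind κR)) *
        (ν₁ univ * (ν₁ univ)⁻¹) by ring,
    ENNReal.mul_inv_cancel h1 (measure_ne_top ν₁ univ), mul_one]

/-- **At `c = ΔF` the two normalised acceptance rates coincide.** -/
theorem lintegral_accF_eq_lintegral_accR_freeEnergyDiff [IsFiniteMeasure ν₀] [IsFiniteMeasure ν₁]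
    (h0 : ν₀ univ ≠ 0) (h1 : ν₁ univ ≠ 0) (h : CrooksPair ν₀ ν₁ κF κR s e W) {ΔF : ℝ}
    (hΔF : Real.exp (-ΔF) = ((ν₀ univ)⁻¹ * ν₁ univ).toReal) :
    ∫⁻ ε, accF ΔF W ε ∂(fwdPathLaw ν₀ κF) = ∫⁻ ε, accR ΔF W ε ∂(fwdPathLaw ν₁ κR) := by
  rw [h.lintegral_accF_eq_exp_mul_lintegral_accR h0 h1 hΔF ΔF, sub_self, Real.exp_zero,
    ENNReal.ofReal_one, one_mul]

/-- **Equal acceptance rates single out `ΔF`**: if the reverse lane's normalised acceptance rate at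
`c` is neither `0` nor `∞`, the two rates coincide iff `c = ΔF` (population form of an
acceptance-ratio estimate with the Metropolis function). -/
theorem lintegral_accF_eq_lintegral_accR_iff [IsFiniteMeasure ν₀] [IsFiniteMeasure ν₁]
    (h0 : ν₀ univ ≠ 0) (h1 : ν₁ univ ≠ 0) (h : CrooksPair ν₀ ν₁ κF κR s e W) {ΔF : ℝ}
    (hΔF : Real.exp (-ΔF) = ((ν₀ univ)⁻¹ * ν₁ univ).toReal) {c : ℝ}
    (hR0 : ∫⁻ ε, accR c W ε ∂(fwdPathLaw ν₁ κR) ≠ 0) (hRtop : ∫⁻ ε, accR c W ε ∂(fwdPathLaw ν₁ κR) ≠ ⊤) :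
    ∫⁻ ε, accF c W ε ∂(fwdPathLaw ν₀ κF) = ∫⁻ ε, accR c W ε ∂(fwdPathLaw ν₁ κR) ↔ c = ΔF := by
  rw [h.lintegral_accF_eq_exp_mul_lintegral_accR h0 h1 hΔF c]
  constructor
  · intro heq
    have hone : ENNReal.ofReal (Real.exp (c - ΔF)) = 1 := by
      have := congrArg (· * (∫⁻ ε, accR c W ε ∂(fwdPathLaw ν₁ κR))⁻¹) heq
      simp only [mul_assoc, ENNReal.mul_inv_cancel hR0 hRtop, mul_one] at this
      exact this
    rw [← ENNReal.ofReal_one, ENNReal.ofReal_eq_ofReal_iff (Real.exp_pos _).le zero_le_one,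
      Real.exp_eq_one_iff, sub_eq_zero] at hone
    exact hone
  · rintro rfl
    rw [sub_self, Real.exp_zero, ENNReal.ofReal_one, one_mul]

/-- The same as real numbers: `E_{P_F}[min(1, e^{−(W−ΔF)})] = P_F{W ≤ ΔF} + P_R{ΔF < W}`. -/
theorem integral_accept_freeEnergyDiff [IsFiniteMeasure ν₀] [IsFiniteMeasure ν₁]
    [IsMarkovKernel κF] [IsMarkovKernel κR] (h0 : ν₀ univ ≠ 0) (h1 : ν₁ univ ≠ 0)
    (h : CrooksPair ν₀ ν₁ κF κR s e W) {ΔF : ℝ}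
    (hΔF : Real.exp (-ΔF) = ((ν₀ univ)⁻¹ * ν₁ univ).toReal) :
    ∫ ε, min 1 (Real.exp (-(W ε - ΔF))) ∂(fwdPathLaw ν₀ κF) =
      (fwdPathLaw ν₀ κF).real {ε | W ε ≤ ΔF} + (fwdPathLaw ν₁ κR).real {ε | ΔF < W ε} := by
  haveI := isProbabilityMeasure_fwdPathLaw ν₀ h0 κF
  haveI := isProbabilityMeasure_fwdPathLaw ν₁ h1 κR
  have hm : Measurable fun ε => min 1 (Real.exp (-(W ε - ΔF))) :=
    measurable_const.min (Real.measurable_exp.comp (h.measurable_W.sub measurable_const).neg)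
  rw [integral_eq_lintegral_of_nonneg_ae
      (Eventually.of_forall fun ε => le_min zero_le_one (Real.exp_pos _).le) hm.aestronglyMeasurable]
  change (∫⁻ ε, accF ΔF W ε ∂(fwdPathLaw ν₀ κF)).toReal = _
  rw [h.lintegral_accF_freeEnergyDiff h0 h1 hΔF, ENNReal.toReal_add (measure_ne_top _ _)
    (measure_ne_top _ _)]
  rfl

/-- The reverse lane's normalised acceptance rate at `c = ΔF` is the same real number:
`E_{P_R}[min(1, e^{W − ΔF})] = E_{P_F}[min(1, e^{−(W − ΔF)})]`. -/
theorem integral_accept_rev_eq [IsFiniteMeasure ν₀] [IsFiniteMeasure ν₁]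
    [IsMarkovKernel κF] [IsMarkovKernel κR] (h0 : ν₀ univ ≠ 0) (h1 : ν₁ univ ≠ 0)
    (h : CrooksPair ν₀ ν₁ κF κR s e W) {ΔF : ℝ}
    (hΔF : Real.exp (-ΔF) = ((ν₀ univ)⁻¹ * ν₁ univ).toReal) :
    ∫ ε, min 1 (Real.exp (W ε - ΔF)) ∂(fwdPathLaw ν₁ κR) =
      ∫ ε, min 1 (Real.exp (-(W ε - ΔF))) ∂(fwdPathLaw ν₀ κF) := by
  have hmF : Measurable fun ε => min 1 (Real.exp (-(W ε - ΔF))) :=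
    measurable_const.min (Real.measurable_exp.comp (h.measurable_W.sub measurable_const).neg)
  have hmR : Measurable fun ε => min 1 (Real.exp (W ε - ΔF)) :=
    measurable_const.min (Real.measurable_exp.comp (h.measurable_W.sub measurable_const))
  rw [integral_eq_lintegral_of_nonneg_ae
      (Eventually.of_forall fun ε => le_min zero_le_one (Real.exp_pos _).le) hmR.aestronglyMeasurable,
    integral_eq_lintegral_of_nonneg_ae
      (Eventually.of_forall fun ε => le_min zero_le_one (Real.exp_pos _).le) hmF.aestronglyMeasurable]
  change (∫⁻ ε, accR ΔF W ε ∂(fwdPathLaw ν₁ κR)).toReal = (∫⁻ ε, accF ΔF W ε ∂(fwdPathLaw ν₀ κF)).toReal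
  rw [h.lintegral_accF_eq_lintegral_accR_freeEnergyDiff h0 h1 hΔF]

/-- The acceptance integrand `min(1, e^{−(W−ΔF)})` is `P_F`-integrable (bounded by one). -/
theorem integrable_accept [IsFiniteMeasure ν₀] [IsMarkovKernel κF] (h0 : ν₀ univ ≠ 0)
    (h : CrooksPair ν₀ ν₁ κF κR s e W) (ΔF : ℝ) :
    Integrable (fun ε => min 1 (Real.exp (-(W ε - ΔF)))) (fwdPathLaw ν₀ κF) := by
  haveI := isProbabilityMeasure_fwdPathLaw ν₀ h0 κF
  have hmm : AEStronglyMeasurable (fun ε => min 1 (Real.exp (-(W ε - ΔF)))) (fwdPathLaw ν₀ κF) :=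
    (measurable_const.min
      (Real.measurable_exp.comp (h.measurable_W.sub measurable_const).neg)).aestronglyMeasurable
  refine (integrable_const (1 : ℝ)).mono' hmm (Eventually.of_forall fun ε => ?_)
  rw [Real.norm_eq_abs, abs_of_pos (lt_min one_pos (Real.exp_pos _))]
  exact min_le_left _ _

/-- The density `d = e^{ΔF − W}` of `P_R` against `P_F` is `P_F`-integrable … -/
theorem integrable_density [IsFiniteMeasure ν₁] [IsMarkovKernel κR] (h0 : ν₀ univ ≠ 0)
    (h : CrooksPair ν₀ ν₁ κF κR s e W) (ΔF : ℝ) :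
    Integrable (fun ε => Real.exp (ΔF - W ε)) (fwdPathLaw ν₀ κF) := by
  have hsplit : ∀ ε, Real.exp (ΔF - W ε) = Real.exp ΔF * Real.exp (-W ε) := fun ε => by
    rw [sub_eq_add_neg, Real.exp_add]
  simp_rw [hsplit]
  exact (h.integrable_exp_neg_work h0).const_mul _

/-- … with mean one (Jarzynski). -/
theorem integral_density_eq_one [IsMarkovKernel κR] (h : CrooksPair ν₀ ν₁ κF κR s e W) {ΔF : ℝ}
    (hΔF : Real.exp (-ΔF) = ((ν₀ univ)⁻¹ * ν₁ univ).toReal) :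
    ∫ ε, Real.exp (ΔF - W ε) ∂(fwdPathLaw ν₀ κF) = 1 := by
  have hsplit : ∀ ε, Real.exp (ΔF - W ε) = (Real.exp (-ΔF))⁻¹ * Real.exp (-W ε) := fun ε => by
    rw [← Real.exp_neg, ← Real.exp_add]
    congr 1
    ring
  simp_rw [hsplit]
  rw [integral_const_mul, h.integral_exp_neg_work, ← hΔF, inv_mul_cancel₀ (Real.exp_pos _).ne']

/-! ## Domination on either side of `W = ΔF` -/

/-- On records with `W > ΔF` the reverse law is dominated by the forward law
(`dP_R/dP_F = e^{ΔF − W} < 1` there). -/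
theorem revPathLaw_le_of_subset [IsFiniteMeasure ν₀] [IsFiniteMeasure ν₁] [IsMarkovKernel κR]
    (h0 : ν₀ univ ≠ 0) (h1 : ν₁ univ ≠ 0) (h : CrooksPair ν₀ ν₁ κF κR s e W) {ΔF : ℝ}
    (hΔF : Real.exp (-ΔF) = ((ν₀ univ)⁻¹ * ν₁ univ).toReal) {S : Set E} (hS : MeasurableSet S)
    (hSub : S ⊆ {ε | ΔF < W ε}) : fwdPathLaw ν₁ κR S ≤ fwdPathLaw ν₀ κF S := by
  rw [h.revPathLaw_eq_withDensity h0 h1 hΔF, withDensity_apply _ hS]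
  calc ∫⁻ ε in S, ENNReal.ofReal (Real.exp (ΔF - W ε)) ∂(fwdPathLaw ν₀ κF)
      ≤ ∫⁻ _ in S, 1 ∂(fwdPathLaw ν₀ κF) :=
        setLIntegral_mono measurable_const fun ε hε => by
          rw [ENNReal.ofReal_le_one, Real.exp_le_one_iff, sub_nonpos]
          exact le_of_lt (hSub hε)
    _ = fwdPathLaw ν₀ κF S := setLIntegral_one S

/-- On records with `W ≤ ΔF` the forward law is dominated by the reverse law
(`dP_R/dP_F = e^{ΔF − W} ≥ 1` there). -/
theorem fwdPathLaw_le_of_subset [IsFiniteMeasure ν₀] [IsFiniteMeasure ν₁] [IsMarkovKernel κR]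
    (h0 : ν₀ univ ≠ 0) (h1 : ν₁ univ ≠ 0) (h : CrooksPair ν₀ ν₁ κF κR s e W) {ΔF : ℝ}
    (hΔF : Real.exp (-ΔF) = ((ν₀ univ)⁻¹ * ν₁ univ).toReal) {S : Set E} (hS : MeasurableSet S)
    (hSub : S ⊆ {ε | W ε ≤ ΔF}) : fwdPathLaw ν₀ κF S ≤ fwdPathLaw ν₁ κR S := by
  have hd : Measurable fun ε => ENNReal.ofReal (Real.exp (ΔF - W ε)) :=
    (Real.measurable_exp.comp (measurable_const.sub h.measurable_W)).ennreal_ofReal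
  rw [h.revPathLaw_eq_withDensity h0 h1 hΔF, withDensity_apply _ hS]
  calc fwdPathLaw ν₀ κF S = ∫⁻ _ in S, 1 ∂(fwdPathLaw ν₀ κF) := (setLIntegral_one S).symm
    _ ≤ ∫⁻ ε in S, ENNReal.ofReal (Real.exp (ΔF - W ε)) ∂(fwdPathLaw ν₀ κF) :=
        setLIntegral_mono hd fun ε hε => by
          rw [← ENNReal.ofReal_one]
          refine ENNReal.ofReal_le_ofReal ?_
          rw [← Real.exp_zero]
          exact Real.exp_le_exp.2 (sub_nonneg.2 (hSub hε))

/-! ## Acceptance = 1 − total variation -/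

/-- **The switch acceptance bounds every discrepancy between the lanes**: for every measurable set
of records `A`, `|P_F(A) − P_R(A)| ≤ P_F{W > ΔF} − P_R{W > ΔF}`. -/
theorem abs_measureReal_sub_le [IsFiniteMeasure ν₀] [IsFiniteMeasure ν₁] [IsMarkovKernel κF]
    [IsMarkovKernel κR] (h0 : ν₀ univ ≠ 0) (h1 : ν₁ univ ≠ 0)
    (h : CrooksPair ν₀ ν₁ κF κR s e W) {ΔF : ℝ}
    (hΔF : Real.exp (-ΔF) = ((ν₀ univ)⁻¹ * ν₁ univ).toReal) {A : Set E} (hA : MeasurableSet A) :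
    |(fwdPathLaw ν₀ κF).real A - (fwdPathLaw ν₁ κR).real A| ≤
      (fwdPathLaw ν₀ κF).real {ε | ΔF < W ε} - (fwdPathLaw ν₁ κR).real {ε | ΔF < W ε} := by
  haveI := isProbabilityMeasure_fwdPathLaw ν₀ h0 κF
  haveI := isProbabilityMeasure_fwdPathLaw ν₁ h1 κR
  set PF := fwdPathLaw ν₀ κF with hPF
  set PR := fwdPathLaw ν₁ κR with hPR
  set B : Set E := {ε | ΔF < W ε} with hB
  have hBm : MeasurableSet B := measurableSet_lt measurable_const h.measurable_W
  have hBc : Bᶜ = {ε | W ε ≤ ΔF} := by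
    ext ε
    simp only [hB, mem_compl_iff, mem_setOf_eq, not_lt]
  -- real-valued domination on the four pieces
  have dom1 : ∀ {S : Set E}, MeasurableSet S → S ⊆ B → PR.real S ≤ PF.real S :=
    fun hS hSub => ENNReal.toReal_mono (measure_ne_top _ _)
      (h.revPathLaw_le_of_subset h0 h1 hΔF hS hSub)
  have dom2 : ∀ {S : Set E}, MeasurableSet S → S ⊆ Bᶜ → PF.real S ≤ PR.real S :=
    fun hS hSub => ENNReal.toReal_mono (measure_ne_top _ _)
      (h.fwdPathLaw_le_of_subset h0 h1 hΔF hS (hBc ▸ hSub))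
  -- decompositions
  have hAF := measureReal_inter_add_sdiff (μ := PF) (s := A) hBm
  have hAR := measureReal_inter_add_sdiff (μ := PR) (s := A) hBm
  have hBF := measureReal_inter_add_sdiff (μ := PF) (s := B) hA
  have hBR := measureReal_inter_add_sdiff (μ := PR) (s := B) hA
  have hBcF := measureReal_inter_add_sdiff (μ := PF) (s := Bᶜ) hA
  have hBcR := measureReal_inter_add_sdiff (μ := PR) (s := Bᶜ) hA
  have hcF : PF.real Bᶜ = 1 - PF.real B := probReal_compl_eq_one_sub hBm
  have hcR : PR.real Bᶜ = 1 - PR.real B := probReal_compl_eq_one_sub hBm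
  have e1 : PR.real (B \ A) ≤ PF.real (B \ A) := dom1 (hBm.diff hA) sdiff_subset
  have e2 : PF.real (A \ B) ≤ PR.real (A \ B) := dom2 (hA.diff hBm) (fun ε hε => hε.2)
  have e3 : PR.real (A ∩ B) ≤ PF.real (A ∩ B) := dom1 (hA.inter hBm) inter_subset_right
  have e4 : PF.real (Bᶜ \ A) ≤ PR.real (Bᶜ \ A) := dom2 (hBm.compl.diff hA) sdiff_subset
  have i1 : A ∩ B = B ∩ A := inter_comm A B
  have i2 : A \ B = Bᶜ ∩ A := by rw [sdiff_eq, inter_comm]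
  rw [i1] at hAF hAR e3
  rw [i2] at hAF hAR e2
  rw [abs_sub_le_iff]
  constructor <;> linarith

/-- **… with equality at `A = {W > ΔF}`, and that number is the rejection rate**:
`P_F{W > ΔF} − P_R{W > ΔF} = 1 − acc(ΔF)`. -/
theorem measureReal_sub_eq_one_sub_accept [IsFiniteMeasure ν₀] [IsFiniteMeasure ν₁]
    [IsMarkovKernel κF] [IsMarkovKernel κR] (h0 : ν₀ univ ≠ 0) (h1 : ν₁ univ ≠ 0)
    (h : CrooksPair ν₀ ν₁ κF κR s e W) {ΔF : ℝ}
    (hΔF : Real.exp (-ΔF) = ((ν₀ univ)⁻¹ * ν₁ univ).toReal) :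
    (fwdPathLaw ν₀ κF).real {ε | ΔF < W ε} - (fwdPathLaw ν₁ κR).real {ε | ΔF < W ε} =
      1 - ∫ ε, min 1 (Real.exp (-(W ε - ΔF))) ∂(fwdPathLaw ν₀ κF) := by
  haveI := isProbabilityMeasure_fwdPathLaw ν₀ h0 κF
  have hBm : MeasurableSet {ε | ΔF < W ε} := measurableSet_lt measurable_const h.measurable_W
  have hBc : ({ε | ΔF < W ε} : Set E)ᶜ = {ε | W ε ≤ ΔF} := by
    ext ε
    simp only [mem_compl_iff, mem_setOf_eq, not_lt]
  rw [h.integral_accept_freeEnergyDiff h0 h1 hΔF, ← hBc, probReal_compl_eq_one_sub hBm]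
  ring

/-- **The mean acceptance of the Metropolized switch at `c = ΔF` is one minus the total-variation
distance between the forward and the reverse path laws** (operational form): for every measurable
set of records `A`, `|P_F(A) − P_R(A)| ≤ 1 − E_{P_F}[min(1, e^{−(W−ΔF)})]`, and the bound is attained
(`measureReal_sub_eq_one_sub_accept`). -/
theorem abs_measureReal_sub_le_one_sub_accept [IsFiniteMeasure ν₀] [IsFiniteMeasure ν₁]
    [IsMarkovKernel κF] [IsMarkovKernel κR] (h0 : ν₀ univ ≠ 0) (h1 : ν₁ univ ≠ 0)
    (h : CrooksPair ν₀ ν₁ κF κR s e W) {ΔF : ℝ}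
    (hΔF : Real.exp (-ΔF) = ((ν₀ univ)⁻¹ * ν₁ univ).toReal) {A : Set E} (hA : MeasurableSet A) :
    |(fwdPathLaw ν₀ κF).real A - (fwdPathLaw ν₁ κR).real A| ≤
      1 - ∫ ε, min 1 (Real.exp (-(W ε - ΔF))) ∂(fwdPathLaw ν₀ κF) := by
  rw [← h.measureReal_sub_eq_one_sub_accept h0 h1 hΔF]
  exact h.abs_measureReal_sub_le h0 h1 hΔF hA

/-- **`L¹` form**: `1 − acc(ΔF) = ½ E_{P_F}|1 − e^{ΔF − W}|` — the rejection rate is half the mean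
absolute deviation of the density `dP_R/dP_F = e^{−W_d}` from one, i.e. the total-variation distance
`½ ‖P_F − P_R‖₁` (pointwise `|1 − d| = 1 + d − 2 min(1, d)` and `E_{P_F}[d] = 1`, Jarzynski). -/
theorem one_sub_accept_eq_half_integral_abs [IsFiniteMeasure ν₀] [IsFiniteMeasure ν₁]
    [IsMarkovKernel κF] [IsMarkovKernel κR] (h0 : ν₀ univ ≠ 0)
    (h : CrooksPair ν₀ ν₁ κF κR s e W) {ΔF : ℝ}
    (hΔF : Real.exp (-ΔF) = ((ν₀ univ)⁻¹ * ν₁ univ).toReal) :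
    1 - ∫ ε, min 1 (Real.exp (-(W ε - ΔF))) ∂(fwdPathLaw ν₀ κF) =
      (1 / 2) * ∫ ε, |1 - Real.exp (ΔF - W ε)| ∂(fwdPathLaw ν₀ κF) := by
  haveI := isProbabilityMeasure_fwdPathLaw ν₀ h0 κF
  have hdi : Integrable (fun ε => Real.exp (ΔF - W ε)) (fwdPathLaw ν₀ κF) := h.integrable_density h0 ΔF
  have hd1 : ∫ ε, Real.exp (ΔF - W ε) ∂(fwdPathLaw ν₀ κF) = 1 := h.integral_density_eq_one hΔF
  have hmi : Integrable (fun ε => min 1 (Real.exp (-(W ε - ΔF)))) (fwdPathLaw ν₀ κF) :=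
    h.integrable_accept h0 ΔF
  -- pointwise identity
  have hpt : ∀ ε, |1 - Real.exp (ΔF - W ε)| =
      1 + Real.exp (ΔF - W ε) - 2 * min 1 (Real.exp (-(W ε - ΔF))) := fun ε => by
    rw [show -(W ε - ΔF) = ΔF - W ε by ring]
    by_cases hle : Real.exp (ΔF - W ε) ≤ 1
    · rw [min_eq_right hle, abs_of_nonneg (by linarith)]
      ring
    · rw [min_eq_left (le_of_lt (not_le.1 hle)), abs_of_neg (by linarith [not_le.1 hle])]
      ring
  have hA : Integrable (fun ε => 1 + Real.exp (ΔF - W ε)) (fwdPathLaw ν₀ κF) :=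
    (integrable_const 1).add hdi
  have hB : Integrable (fun ε => 2 * min 1 (Real.exp (-(W ε - ΔF)))) (fwdPathLaw ν₀ κF) :=
    hmi.const_mul 2
  simp_rw [hpt]
  rw [integral_sub hA hB, integral_add (integrable_const 1) hdi, integral_const_mul, integral_const,
    smul_eq_mul, probReal_univ, hd1]
  ring

/-- **Full acceptance iff the two path laws coincide** (iff the work is a.s. `ΔF`,
`NCMCGeneralSpaceRelativeEntropy.fwdPathLaw_eq_revPathLaw_iff`): `acc(ΔF) = 1 ↔ P_F = P_R`. -/
theorem accept_eq_one_iff [IsFiniteMeasure ν₀] [IsFiniteMeasure ν₁] [IsMarkovKernel κF]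
    [IsMarkovKernel κR] (h0 : ν₀ univ ≠ 0) (h1 : ν₁ univ ≠ 0) (h : CrooksPair ν₀ ν₁ κF κR s e W)
    {ΔF : ℝ} (hΔF : Real.exp (-ΔF) = ((ν₀ univ)⁻¹ * ν₁ univ).toReal) :
    ∫ ε, min 1 (Real.exp (-(W ε - ΔF))) ∂(fwdPathLaw ν₀ κF) = 1 ↔
      fwdPathLaw ν₀ κF = fwdPathLaw ν₁ κR := by
  haveI := isProbabilityMeasure_fwdPathLaw ν₀ h0 κF
  haveI := isProbabilityMeasure_fwdPathLaw ν₁ h1 κR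
  constructor
  · intro hacc
    ext A hA
    have hle := h.abs_measureReal_sub_le_one_sub_accept h0 h1 hΔF hA
    rw [hacc, sub_self] at hle
    have heq : (fwdPathLaw ν₀ κF).real A = (fwdPathLaw ν₁ κR).real A := by
      have := abs_nonneg ((fwdPathLaw ν₀ κF).real A - (fwdPathLaw ν₁ κR).real A)
      have h0' : |(fwdPathLaw ν₀ κF).real A - (fwdPathLaw ν₁ κR).real A| = 0 := le_antisymm hle this
      rw [abs_eq_zero, sub_eq_zero] at h0'
      exact h0'
    exact (ENNReal.toReal_eq_toReal_iff' (measure_ne_top _ _) (measure_ne_top _ _)).1 heq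
  · intro hPP
    have hae : ∀ᵐ ε ∂(fwdPathLaw ν₀ κF), W ε = ΔF :=
      (h.fwdPathLaw_eq_revPathLaw_iff h0 h1 hΔF).1 hPP
    calc ∫ ε, min 1 (Real.exp (-(W ε - ΔF))) ∂(fwdPathLaw ν₀ κF)
        = ∫ _, (1 : ℝ) ∂(fwdPathLaw ν₀ κF) := by
          refine integral_congr_ae (hae.mono fun ε hε => ?_)
          simp only [hε, sub_self, neg_zero, Real.exp_zero, min_self]
      _ = 1 := by rw [integral_const, smul_eq_mul, mul_one, probReal_univ]

end CrooksPair

end Summit.Ventures.LatticeQCDFlow.Exactness.GeneralNCMC
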